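import Literature.MathematicalPhysics.QuantumFieldTheory.Balaban1983to89.B12Ineq417General

/-!
# `Balaban1983to89.B12Ineq417DeltaB` — [Balaban1987RG1] p. 285: «The inequalities (4.17), (4.18) hold for the field δB also» —
the (4.17) half, for the functional derivative `δB = ⟨(δ/δA)Q_j(ηA), W⟩` of (4.6), at a GENERAL background from displayed inputs
(chart + analyticity + size of `Q_j(U₀, ·)`, background variation) by Cauchy estimates for the FIRST DERIVATIVE, with the inputs
DISCHARGED at `U₀ = 1`

HONEST FRAMING (cell `lit-balaban`, verbatim): statement-level skeleton of published theorems with citation tags; proofs where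
landed; nothing here is a claim about the Yang–Mills mass gap.

CITATION HEADER.  T. Bałaban, *Renormalization group approach to lattice gauge field theories. I*, Commun. Math. Phys. **109** (1987)
249–301 [Balaban1987RG1] (cell paper B12; journal page = PDF page + 248): (4.6) p. 282 («δB = ⟨(δ/δA)Q_j(ηA), η⟨(δ/δ𝐀)A,
ζ_□𝐇_j(B′)⟩⟩», «The fields A and ⟨(δ/δ𝐀)A, ζ_□𝐇_k(B′)⟩ satisfy the bounds (3.32), the second field is localized in supp ζ_□, hence
δB is localized in □»), (4.16)–(4.17) p. 285 and the sentence «The inequalities (4.17), (4.18) hold for the field δB also» (p. 285,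
after (4.18)); T. Bałaban, *Averaging operations for lattice gauge theories*, Commun. Math. Phys. **98** (1985) 17–51
[Balaban1985Averaging] (cell paper B7), Proposition 4 p. 38 ((131), analyticity), Proposition 5 p. 42 ((156)–(157), functional derivatives of
the averaging operations; proved pp. 40–41), (127) p. 37.  Unit `lit-balaban-r20` gen 4 (fold owner of B12): SUPPLEMENT to row B12.Eq4.16-4.18 (owner cell
r09 `typed p243650`; r20 supplements `B12Ineq417Flat` p246801, `B12Ineq418Flat` p247232, `B7TranslationCovariance` p247411,
`B12Ineq417General` p247730) — its «for δB also» sentence, (4.17) half.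

THE OBJECT.  `dQ L U₀ F W j z μ := d/ds|_{s=0} Q_{j,μ}(U₀, F + sW)(z)` — the functional derivative of the background-covariant
composite averaging (127) of [7] at `F` in the direction `W`; the print's `δB` is `dQ` at `U₀ = U_j(□₀, 1)`, `F = ηA`,
`W = η⟨(δ/δ𝐀)A, ζ_□𝐇_j(B′)⟩` (no `ζ̃_□` weight: «δB is localized in □» by the `ζ_□` inside `W`).

THE MECHANISM (as for (4.17), `B12Ineq417General`).  Translation covariance `dQ(U₀; F; W)(z + a) = dQ(tU₀; tF; tW)(z)`, `t = t_{L^ja}`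
(`dQ_shiftCfg`, from `B7TranslationCovariance.logCovIter_shiftCfg`), splits `∂_ν δB_μ(z)` into a DIRECTION-variation term
`dQ(tU₀; tF; tW − W)` (linear in the direction), a BASE-POINT-variation term `dQ(tU₀; tF; W) − dQ(tU₀; F; W)` and a BACKGROUND-variation
term `dQ(tU₀; F; W) − dQ(U₀; F; W)`.  Through a chart `Q_{j,μ}(tU₀, G)(z) = φ(G|_S)` with `φ` holomorphic on the sup-norm ball of radius
`b₁` and bounded by `M` there, `dQ = Dφ(F|_S)[W|_S]` (`dQ_eq_fderiv_of_chart`) and the Cauchy estimates give `‖Dφ(p)[w]‖ ≤ M‖w‖/ρ`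
(`norm_fderiv_apply_le_of_chart`, from `B12CauchyRemainder354.norm_iteratedDeriv_le_of_ball`) and `‖Dφ(p+v)[w] − Dφ(p)[w]‖ ≤ M‖w‖‖v‖/ρ²`
(`norm_fderiv_apply_sub_le_of_chart`: the holomorphic `q ↦ Dφ(q)[w]`, bounded by `M‖w‖/ρ` on the ball of radius `b₁ − ρ`, fed to
`B12Ineq417General.norm_sub_le_of_chart`).  Hence (`ineq417_deltaB_general`) `‖∂_ν δB_μ(z)‖ ≤ M·L^jg_W/ρ + M·ω·L^jg/ρ² + ε_bg`
(`g`, `g_W` the fine `ν`-differences of `F`, `W`; `ω = sup ‖W‖`; margin `b + L^jg + 2ρ ≤ b₁`); at `U₀ = 1` every input is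
discharged (`ineq417_deltaB_flat`, `ε_bg = 0`, `M = 2L^jb₁` by (131), `C₃L^jb₁ ≤ 1`).  DICTIONARY ([Balaban1987RG1] (3.32), as in
`B12Ineq417Flat`): `b, b₁, ρ, ω = O(η)`, `g, g_W = O(η²)` ⟹ both terms are `O(1)(L^jη)²` — the printed law for `δB`.

WHAT THIS FILE PROVES (kernel, 0 sorry, standard axioms; one object definition `dQ`, no `def … : Prop`): §1 `norm_fderiv_apply_le_of_chart`,
`differentiableOn_fderiv_apply`, `norm_fderiv_apply_sub_le_of_chart`; §2 `dQ`, `dQ_one`, `shiftCfg_add_smul`, `dQ_shiftCfg`,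
`restr_add_smul`, `hasDerivAt_of_chart`, `dQ_eq_fderiv_of_chart`; §3 **`ineq417_deltaB_general`**; §4 **`ineq417_deltaB_flat`**.

DIVERGENCES / NOT PROVED.  `ℤ^d`, no torus; constants OURS; the (4.18) half for `δB` is not treated; at a general background the
chart/analyticity/size/background-variation inputs are hypotheses displayed in the theorem; the identification of `W` with the printed
`η⟨(δ/δ𝐀)A, ζ_□𝐇_j(B′)⟩` and of its bounds with (3.32) is the DICTIONARY above, not a Lean statement.
DOCFIX (r20 g20, 2026-08-22): quotation span of `ineq417_deltaB_flat` corrected to the print — QF57-004 (summit-lit1 g57 `qfid_slips_g57.tsv`, confirmed r09 g19 / r20 g20 on `paper:balaban1987-cmp109-rg-i-small-field` p0037 L21–22: «The inequalities (4.17), (4.18) hold for the field δB also.»); docstring-only, declarations byte-identical.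
-/

noncomputable section

open scoped BigOperators
open Set Metric
open Literature.MathematicalPhysics.QuantumFieldTheory.Balaban1983to89
open Literature.MathematicalPhysics.QuantumFieldTheory.Balaban1983to89.B7Prop1Explicit (e)
open Literature.MathematicalPhysics.QuantumFieldTheory.Balaban1983to89.B7Prop3Flat (insCfg)
open Literature.MathematicalPhysics.QuantumFieldTheory.Balaban1983to89.B7Prop4Flat (logIter)
open Literature.MathematicalPhysics.QuantumFieldTheory.Balaban1983to89.B7Prop5Flat (C3 C3_pos restr)
open Literature.MathematicalPhysics.QuantumFieldTheory.Balaban1983to89.B7Prop5FlatOperator (avgMap avgMap_apply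
  analyticAt_avgMap_apply norm_insCfg_le_of_le)
open Literature.MathematicalPhysics.QuantumFieldTheory.Balaban1983to89.B7Prop4GeneralLevels (logCovIter logCovIter_one_left)
open Literature.MathematicalPhysics.QuantumFieldTheory.Balaban1983to89.B12Ineq417Flat (shiftCfg shiftCfg_apply boxBonds oneBond
  theBond logIter_eq_avgMap_restr norm_logIter_le)
open Literature.MathematicalPhysics.QuantumFieldTheory.Balaban1983to89.B12CauchyRemainder354 (norm_iteratedDeriv_le_of_ball)
open Literature.MathematicalPhysics.QuantumFieldTheory.Balaban1983to89.B7TranslationCovariance (shiftCfg_one logCovIter_shiftCfg)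
open Literature.MathematicalPhysics.QuantumFieldTheory.Balaban1983to89.B12Ineq417General (norm_sub_le_of_chart norm_restr_le
  norm_restr_shift_sub_le)

namespace Literature.MathematicalPhysics.QuantumFieldTheory.Balaban1983to89.B12Ineq417DeltaB

variable {d : ℕ}

/-! ## §1 Cauchy estimates for the first derivative through a chart -/

section Cauchy

variable {P F : Type*} [NormedAddCommGroup P] [NormedSpace ℂ P] [NormedAddCommGroup F] [NormedSpace ℂ F] [CompleteSpace F]

/-- **Cauchy estimate for a directional derivative**: if `φ` is holomorphic on the ball `‖q‖ < b₁` and bounded there by `M`, then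
for `‖p‖ + ρ ≤ b₁`, `ρ > 0`: `‖Dφ(p)[w]‖ ≤ M‖w‖/ρ` (the estimate `|g′(0)| ≤ M/R` for `g(s) = φ(p + sw)` on `|s| < R = ρ/‖w‖`).
This is the operator-type bound on functional derivatives of analytic averaging functionals the print takes from «Proposition 5 [7]».
[cite: Balaban1987RG1, (4.17) p.285; Balaban1985Averaging, Prop. 5 p.42] (standard complex analysis; our proof) -/
theorem norm_fderiv_apply_le_of_chart {φ : P → F} {b₁ M ρ : ℝ} (hφ : DifferentiableOn ℂ φ (ball 0 b₁))
    (hM : ∀ q ∈ ball (0 : P) b₁, ‖φ q‖ ≤ M) (hρ : 0 < ρ) (p w : P) (hp : ‖p‖ + ρ ≤ b₁) :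
    ‖fderiv ℂ φ p w‖ ≤ M * ‖w‖ / ρ := by
  by_cases hw : w = 0
  · subst hw; simp
  have hwpos : 0 < ‖w‖ := norm_pos_iff.2 hw
  set R : ℝ := ρ / ‖w‖ with hR
  have hR0 : 0 < R := div_pos hρ hwpos
  have hmaps : ∀ s ∈ ball (0 : ℂ) R, p + s • w ∈ ball (0 : P) b₁ := by
    intro s hs
    rw [mem_ball_zero_iff] at hs ⊢
    have h1 : ‖s‖ * ‖w‖ < ρ := by
      have := mul_lt_mul_of_pos_right hs hwpos
      rwa [hR, div_mul_cancel₀ _ hwpos.ne'] at this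
    calc ‖p + s • w‖ ≤ ‖p‖ + ‖s • w‖ := norm_add_le _ _
      _ = ‖p‖ + ‖s‖ * ‖w‖ := by rw [norm_smul]
      _ < ‖p‖ + ρ := by linarith
      _ ≤ b₁ := hp
  have hpmem : p ∈ ball (0 : P) b₁ := by simpa using hmaps 0 (mem_ball_self hR0)
  have hg : DifferentiableOn ℂ (fun s : ℂ => φ (p + s • w)) (ball 0 R) :=
    hφ.comp ((differentiableOn_const p).add (differentiableOn_id.smul_const w)) fun s hs => hmaps s hs
  have hgM : ∀ s ∈ ball (0 : ℂ) R, ‖φ (p + s • w)‖ ≤ M := fun s hs => hM _ (hmaps s hs)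
  have hc := norm_iteratedDeriv_le_of_ball hR0 hg hgM 1
  rw [iteratedDeriv_one, Nat.factorial_one, Nat.cast_one, one_mul, pow_one] at hc
  -- identify the derivative of the line function with `Dφ(p)[w]`
  have hφp : HasFDerivAt φ (fderiv ℂ φ p) p := (hφ.differentiableAt (isOpen_ball.mem_nhds hpmem)).hasFDerivAt
  have hline : HasDerivAt (fun s : ℂ => p + s • w) w 0 := by
    simpa using ((hasDerivAt_id (0 : ℂ)).smul_const w).const_add p
  have hderiv : HasDerivAt (fun s : ℂ => φ (p + s • w)) (fderiv ℂ φ p w) 0 :=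
    hφp.comp_hasDerivAt_of_eq 0 hline (by simp)
  rw [hderiv.deriv] at hc
  calc ‖fderiv ℂ φ p w‖ ≤ M / R := hc
    _ = M * ‖w‖ / ρ := by rw [hR, div_div_eq_mul_div]

/-- For `φ` analytic on an open set, `q ↦ Dφ(q)[w]` is holomorphic there. [cite: Balaban1985Averaging, Prop. 4 p.38, Prop. 5 p.42]
(standard; our proof) -/
theorem differentiableOn_fderiv_apply {φ : P → F} {U : Set P} (hφ : AnalyticOnNhd ℂ φ U) (w : P) :
    DifferentiableOn ℂ (fun q => fderiv ℂ φ q w) U := fun q hq =>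
  ((hφ q hq).fderiv.differentiableAt.clm_apply (differentiableAt_const w)).differentiableWithinAt

/-- **Cauchy estimate for the variation of a directional derivative in the base point**: `φ` analytic on the ball `‖q‖ < b₁`,
`‖φ‖ ≤ M` there, `ρ > 0`, `‖p‖ + ‖v‖ + 2ρ ≤ b₁` ⟹ `‖Dφ(p+v)[w] − Dφ(p)[w]‖ ≤ M‖w‖‖v‖/ρ²` (the holomorphic `q ↦ Dφ(q)[w]`
is bounded by `M‖w‖/ρ` on the ball of radius `b₁ − ρ`, and `B12Ineq417General.norm_sub_le_of_chart` applies with margin `ρ`).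
[cite: Balaban1987RG1, (4.17) p.285; Balaban1985Averaging, Prop. 5 p.42] (standard complex analysis; our proof) -/
theorem norm_fderiv_apply_sub_le_of_chart {φ : P → F} {b₁ M ρ : ℝ} (hφ : AnalyticOnNhd ℂ φ (ball 0 b₁))
    (hM : ∀ q ∈ ball (0 : P) b₁, ‖φ q‖ ≤ M) (hρ : 0 < ρ) (p v w : P) (hpv : ‖p‖ + ‖v‖ + 2 * ρ ≤ b₁) :
    ‖fderiv ℂ φ (p + v) w - fderiv ℂ φ p w‖ ≤ M * ‖w‖ * ‖v‖ / ρ ^ 2 := by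
  have hsub : ball (0 : P) (b₁ - ρ) ⊆ ball 0 b₁ := ball_subset_ball (by linarith)
  have hψ : DifferentiableOn ℂ (fun q => fderiv ℂ φ q w) (ball 0 (b₁ - ρ)) :=
    (differentiableOn_fderiv_apply hφ w).mono hsub
  have hψM : ∀ q ∈ ball (0 : P) (b₁ - ρ), ‖fderiv ℂ φ q w‖ ≤ M * ‖w‖ / ρ := fun q hq =>
    norm_fderiv_apply_le_of_chart hφ.differentiableOn hM hρ q w (by rw [mem_ball_zero_iff] at hq; linarith)
  have h := norm_sub_le_of_chart hψ hψM hρ p v (by linarith)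
  calc ‖fderiv ℂ φ (p + v) w - fderiv ℂ φ p w‖ ≤ M * ‖w‖ / ρ * ‖v‖ / ρ := h
    _ = M * ‖w‖ * ‖v‖ / ρ ^ 2 := by
        have hρ0 : ρ ≠ 0 := hρ.ne'
        field_simp

end Cauchy

/-! ## §2 The functional derivative `δQ` of the composite averaging, its covariance and its chart form -/

section Lattice

variable {𝔸 : Type*} [NormedRing 𝔸] [NormedAlgebra ℂ 𝔸] [CompleteSpace 𝔸]

/-- **«δB = ⟨(δ/δA)Q_j(ηA), W⟩» (4.6)**: the functional derivative of the background-covariant composite averaging `Q_j(U₀, ·)` (127)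
of [7] at the field `F` in the direction `W`, bondwise: `d/ds|_{s=0} Q_{j,μ}(U₀, F + sW)(z)` (complex `s`).
[cite: Balaban1987RG1, (4.6) p.282; Balaban1985Averaging, (127) p.37, Prop. 5 p.42] -/
def dQ (L : ℕ) (U₀ : B7Prop1Explicit.Site d → Fin d → 𝔸ˣ) (F W : B7Prop1Explicit.Site d → Fin d → 𝔸) (j : ℕ)
    (z : B7Prop1Explicit.Site d) (μ : Fin d) : 𝔸 :=
  deriv (fun s : ℂ => logCovIter L U₀ (F + s • W) j z μ) 0

/-- At the flat background `δQ` is the derivative of b07's `logIter` along the direction. [cite: Balaban1987RG1, (4.6) p.282, (4.19) p.285] -/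
theorem dQ_one (L : ℕ) (F W : B7Prop1Explicit.Site d → Fin d → 𝔸) (j : ℕ) (z : B7Prop1Explicit.Site d) (μ : Fin d) :
    dQ L (1 : B7Prop1Explicit.Site d → Fin d → 𝔸ˣ) F W j z μ = deriv (fun s : ℂ => logIter L (F + s • W) j z μ) 0 := by
  simp only [dQ, logCovIter_one_left]

omit [CompleteSpace 𝔸] in
/-- Translations are linear: `t(F + sW) = tF + s·tW`. [cite: Balaban1987RG1, (4.16) p.285] (elementary API; our proof) -/
theorem shiftCfg_add_smul (a : B7Prop1Explicit.Site d) (F W : B7Prop1Explicit.Site d → Fin d → 𝔸) (s : ℂ) :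
    shiftCfg a (F + s • W) = shiftCfg a F + s • shiftCfg a W := rfl

/-- **Translation covariance of `δQ`**: `δQ(U₀; F; W)(z + a) = δQ(t_{L^ja}U₀; t_{L^ja}F; t_{L^ja}W)(z)`.
[cite: Balaban1987RG1, (4.16) p.285 («Q_{j,μ} is translation invariant»); Balaban1985Averaging, (127) p.37] -/
theorem dQ_shiftCfg (L : ℕ) (U₀ : B7Prop1Explicit.Site d → Fin d → 𝔸ˣ) (F W : B7Prop1Explicit.Site d → Fin d → 𝔸) (j : ℕ)
    (a z : B7Prop1Explicit.Site d) (μ : Fin d) :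
    dQ L U₀ F W j (z + a) μ
      = dQ L (shiftCfg (((L : ℤ) ^ j) • a) U₀) (shiftCfg (((L : ℤ) ^ j) • a) F) (shiftCfg (((L : ℤ) ^ j) • a) W) j z μ := by
  unfold dQ
  congr 1
  funext s
  rw [logCovIter_shiftCfg, shiftCfg_add_smul]

omit [NormedAlgebra ℂ 𝔸] [CompleteSpace 𝔸] in
/-- Restriction to a bond set is linear. [cite: Balaban1987RG1, (4.6) p.282] (elementary API; our proof) -/
theorem restr_add_smul {R : Type*} [SMul R 𝔸] (S : Finset (B7Prop1Explicit.Site d × Fin d))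
    (F W : B7Prop1Explicit.Site d → Fin d → 𝔸) (s : R) : restr S (F + s • W) = restr S F + s • restr S W := rfl

/-- **`δQ` through a chart**: if `Q_{j,μ}(U₀, G)(z) = φ(G|_S)` for all `G` and `φ` is differentiable at `F|_S`, then
`s ↦ Q_{j,μ}(U₀, F + sW)(z)` has derivative `Dφ(F|_S)[W|_S]` at `0`. [cite: Balaban1987RG1, (4.6) p.282; Balaban1985Averaging, Prop. 5 p.42] -/
theorem hasDerivAt_of_chart (L : ℕ) (U₀ : B7Prop1Explicit.Site d → Fin d → 𝔸ˣ) (j : ℕ) (z : B7Prop1Explicit.Site d) (μ : Fin d)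
    {S : Finset (B7Prop1Explicit.Site d × Fin d)} (φ : (S → 𝔸) → 𝔸)
    (hchart : ∀ G : B7Prop1Explicit.Site d → Fin d → 𝔸, logCovIter L U₀ G j z μ = φ (restr S G))
    (F W : B7Prop1Explicit.Site d → Fin d → 𝔸) (hφ : DifferentiableAt ℂ φ (restr S F)) :
    HasDerivAt (fun s : ℂ => logCovIter L U₀ (F + s • W) j z μ) (fderiv ℂ φ (restr S F) (restr S W)) 0 := by
  have hfun : (fun s : ℂ => logCovIter L U₀ (F + s • W) j z μ) = fun s : ℂ => φ (restr S F + s • restr S W) := by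
    funext s; rw [hchart, restr_add_smul]
  rw [hfun]
  have hline : HasDerivAt (fun s : ℂ => restr S F + s • restr S W) (restr S W) 0 := by
    simpa using ((hasDerivAt_id (0 : ℂ)).smul_const (restr S W)).const_add (restr S F)
  exact hφ.hasFDerivAt.comp_hasDerivAt_of_eq 0 hline (by simp)

/-- **`δQ = Dφ(F|_S)[W|_S]`** through a chart. [cite: Balaban1987RG1, (4.6) p.282; Balaban1985Averaging, Prop. 5 p.42] -/
theorem dQ_eq_fderiv_of_chart (L : ℕ) (U₀ : B7Prop1Explicit.Site d → Fin d → 𝔸ˣ) (j : ℕ) (z : B7Prop1Explicit.Site d)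
    (μ : Fin d) {S : Finset (B7Prop1Explicit.Site d × Fin d)} (φ : (S → 𝔸) → 𝔸)
    (hchart : ∀ G : B7Prop1Explicit.Site d → Fin d → 𝔸, logCovIter L U₀ G j z μ = φ (restr S G))
    (F W : B7Prop1Explicit.Site d → Fin d → 𝔸) (hφ : DifferentiableAt ℂ φ (restr S F)) :
    dQ L U₀ F W j z μ = fderiv ℂ φ (restr S F) (restr S W) :=
  (hasDerivAt_of_chart L U₀ j z μ φ hchart F W hφ).deriv

end Lattice

/-! ## §3 (4.17) for `δB` at a general background from displayed inputs -/

section General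

variable {𝔸 : Type*} [NormedRing 𝔸] [NormedAlgebra ℂ 𝔸] [CompleteSpace 𝔸]

/-- **(4.17) FOR `δB` AT A GENERAL BACKGROUND FROM DISPLAYED INPUTS.**  Let `t = t_{L^je_ν}`.  INPUTS: (chart)
`Q_{j,μ}(tU₀, G)(z) = φ(G|_S)` for all `G`; (analyticity) `φ` analytic on the sup-norm ball of radius `b₁`; (size) `‖φ‖ ≤ M` there;
(background variation) `‖δQ(tU₀; F; W)(z) − δQ(U₀; F; W)(z)‖ ≤ ε_bg`; data: `sup ‖F‖ ≤ b`, fine `ν`-differences of `F` `≤ g`,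
`sup ‖W‖ ≤ ω`, fine `ν`-differences of `W` `≤ g_W`, margin `b + L^jg + 2ρ ≤ b₁`.  CONCLUSION:
`‖(∂_ν δB_μ)(z)‖ = ‖δQ(U₀;F;W)(z+e_ν) − δQ(U₀;F;W)(z)‖ ≤ M·L^jg_W/ρ + M·ω·L^jg/ρ² + ε_bg`.
[cite: Balaban1987RG1, (4.17) p.285 («hold for the field δB also»), (4.6) p.282; Balaban1985Averaging, Prop. 4 p.38, Prop. 5 p.42] -/
theorem ineq417_deltaB_general (L : ℕ) (U₀ : B7Prop1Explicit.Site d → Fin d → 𝔸ˣ) (F W : B7Prop1Explicit.Site d → Fin d → 𝔸)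
    (j : ℕ) (ν : Fin d) (z : B7Prop1Explicit.Site d) (μ : Fin d) {S : Finset (B7Prop1Explicit.Site d × Fin d)}
    (φ : (S → 𝔸) → 𝔸) {b b₁ M g gW ω ρ εbg : ℝ}
    (hchart : ∀ G : B7Prop1Explicit.Site d → Fin d → 𝔸,
      logCovIter L (shiftCfg (((L : ℤ) ^ j) • e ν) U₀) G j z μ = φ (restr S G))
    (hφ : AnalyticOnNhd ℂ φ (ball 0 b₁)) (hM0 : 0 ≤ M) (hM : ∀ q ∈ ball (0 : S → 𝔸) b₁, ‖φ q‖ ≤ M)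
    (hb : 0 ≤ b) (hF : ∀ x κ, ‖F x κ‖ ≤ b) (hg0 : 0 ≤ g) (hg : ∀ x κ, ‖F (x + e ν) κ - F x κ‖ ≤ g)
    (hω : 0 ≤ ω) (hW : ∀ x κ, ‖W x κ‖ ≤ ω) (hgW0 : 0 ≤ gW) (hgW : ∀ x κ, ‖W (x + e ν) κ - W x κ‖ ≤ gW)
    (hρ : 0 < ρ) (hroom : b + (L : ℝ) ^ j * g + 2 * ρ ≤ b₁)
    (hbg : ‖dQ L (shiftCfg (((L : ℤ) ^ j) • e ν) U₀) F W j z μ - dQ L U₀ F W j z μ‖ ≤ εbg) :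
    ‖dQ L U₀ F W j (z + e ν) μ - dQ L U₀ F W j z μ‖
      ≤ M * ((L : ℝ) ^ j * gW) / ρ + M * ω * ((L : ℝ) ^ j * g) / ρ ^ 2 + εbg := by
  -- the restricted data
  set p : S → 𝔸 := restr S F with hp
  set v : S → 𝔸 := restr S (shiftCfg (((L : ℤ) ^ j) • e ν) F) - restr S F with hv
  set w : S → 𝔸 := restr S W with hw
  set w' : S → 𝔸 := restr S (shiftCfg (((L : ℤ) ^ j) • e ν) W) with hw'
  have hpn : ‖p‖ ≤ b := norm_restr_le S F hb hF
  have hvn : ‖v‖ ≤ (L : ℝ) ^ j * g := norm_restr_shift_sub_le S F L j ν hg0 hg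
  have hwn : ‖w‖ ≤ ω := norm_restr_le S W hω hW
  have hw'n : ‖w' - w‖ ≤ (L : ℝ) ^ j * gW := norm_restr_shift_sub_le S W L j ν hgW0 hgW
  have hpv_eq : restr S (shiftCfg (((L : ℤ) ^ j) • e ν) F) = p + v := by rw [hp, hv]; abel
  have hpv_norm : ‖p + v‖ ≤ b + (L : ℝ) ^ j * g := le_trans (norm_add_le _ _) (add_le_add hpn hvn)
  have hp_mem : p ∈ ball (0 : S → 𝔸) b₁ := by rw [mem_ball_zero_iff]; nlinarith [pow_nonneg (Nat.cast_nonneg L : (0:ℝ) ≤ L) j]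
  have hpv_mem : p + v ∈ ball (0 : S → 𝔸) b₁ := by rw [mem_ball_zero_iff]; linarith
  -- chart identifications at the background tU₀
  have e1 : dQ L (shiftCfg (((L : ℤ) ^ j) • e ν) U₀) (shiftCfg (((L : ℤ) ^ j) • e ν) F)
      (shiftCfg (((L : ℤ) ^ j) • e ν) W) j z μ = fderiv ℂ φ (p + v) w' := by
    have hd : DifferentiableAt ℂ φ (restr S (shiftCfg (((L : ℤ) ^ j) • e ν) F)) := by
      rw [hpv_eq]; exact (hφ _ hpv_mem).differentiableAt
    rw [dQ_eq_fderiv_of_chart L _ j z μ φ hchart _ _ hd, hpv_eq]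
  have e2 : dQ L (shiftCfg (((L : ℤ) ^ j) • e ν) U₀) (shiftCfg (((L : ℤ) ^ j) • e ν) F) W j z μ
      = fderiv ℂ φ (p + v) w := by
    have hd : DifferentiableAt ℂ φ (restr S (shiftCfg (((L : ℤ) ^ j) • e ν) F)) := by
      rw [hpv_eq]; exact (hφ _ hpv_mem).differentiableAt
    rw [dQ_eq_fderiv_of_chart L _ j z μ φ hchart _ _ hd, hpv_eq]
  have e3 : dQ L (shiftCfg (((L : ℤ) ^ j) • e ν) U₀) F W j z μ = fderiv ℂ φ p w :=
    dQ_eq_fderiv_of_chart L _ j z μ φ hchart _ _ (hφ _ hp_mem).differentiableAt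
  -- the two Cauchy bounds
  have hA : ‖fderiv ℂ φ (p + v) w' - fderiv ℂ φ (p + v) w‖ ≤ M * ((L : ℝ) ^ j * gW) / ρ := by
    rw [← map_sub]
    calc ‖fderiv ℂ φ (p + v) (w' - w)‖ ≤ M * ‖w' - w‖ / ρ :=
          norm_fderiv_apply_le_of_chart hφ.differentiableOn hM hρ (p + v) (w' - w) (by linarith)
      _ ≤ M * ((L : ℝ) ^ j * gW) / ρ := div_le_div_of_nonneg_right (mul_le_mul_of_nonneg_left hw'n hM0) hρ.le
  have hB : ‖fderiv ℂ φ (p + v) w - fderiv ℂ φ p w‖ ≤ M * ω * ((L : ℝ) ^ j * g) / ρ ^ 2 := by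
    calc ‖fderiv ℂ φ (p + v) w - fderiv ℂ φ p w‖ ≤ M * ‖w‖ * ‖v‖ / ρ ^ 2 :=
          norm_fderiv_apply_sub_le_of_chart hφ hM hρ p v w (by linarith)
      _ ≤ M * ω * ((L : ℝ) ^ j * g) / ρ ^ 2 :=
          div_le_div_of_nonneg_right (mul_le_mul (mul_le_mul_of_nonneg_left hwn hM0) hvn (norm_nonneg _)
            (by positivity)) (by positivity)
  -- assemble along the covariance split
  rw [dQ_shiftCfg, e1]
  calc ‖fderiv ℂ φ (p + v) w' - dQ L U₀ F W j z μ‖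
      = ‖(fderiv ℂ φ (p + v) w' - fderiv ℂ φ (p + v) w) + (fderiv ℂ φ (p + v) w - fderiv ℂ φ p w)
          + (dQ L (shiftCfg (((L : ℤ) ^ j) • e ν) U₀) F W j z μ - dQ L U₀ F W j z μ)‖ := by
        rw [e3]; congr 1; abel
    _ ≤ ‖fderiv ℂ φ (p + v) w' - fderiv ℂ φ (p + v) w‖ + ‖fderiv ℂ φ (p + v) w - fderiv ℂ φ p w‖
          + ‖dQ L (shiftCfg (((L : ℤ) ^ j) • e ν) U₀) F W j z μ - dQ L U₀ F W j z μ‖ := norm_add₃_le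
    _ ≤ M * ((L : ℝ) ^ j * gW) / ρ + M * ω * ((L : ℝ) ^ j * g) / ρ ^ 2 + εbg := add_le_add (add_le_add hA hB) hbg

end General

/-! ## §4 The inputs discharged at the flat background -/

section Flat

variable {𝔸 : Type*} [NormedRing 𝔸] [NormedAlgebra ℂ 𝔸] [CompleteSpace 𝔸]

/-- **(4.17) FOR `δB` AT `U₀ = 1`** (the print's `U_j(□₀, 1)`, cf. (4.19)): for `L ≥ 2`, `C₃(d, L)·L^j·b₁ ≤ 1`, `sup ‖F‖ ≤ b`, fine
`ν`-differences of `F` `≤ g`, `sup ‖W‖ ≤ ω`, fine `ν`-differences of `W` `≤ g_W`, margin `b + L^jg + 2ρ ≤ b₁`: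
`‖(∂_ν δB_μ)(z)‖ ≤ 2L^jb₁·L^jg_W/ρ + 2L^jb₁·ω·L^jg/ρ²` — `ineq417_deltaB_general` with the chart `B12Ineq417Flat.logIter_eq_avgMap_restr`,
the analyticity `B7Prop5FlatOperator.analyticAt_avgMap_apply`, the size (131) `B12Ineq417Flat.norm_logIter_le`, and `ε_bg = 0`.  With the
DICTIONARY of the header both terms are `O(1)(L^jη)²`: «The inequalities (4.17), (4.18) hold for the field δB also» (p. 285; its (4.17) half).
[cite: Balaban1987RG1, (4.17) p.285, (4.6) p.282; Balaban1985Averaging, Prop. 4 p.38, (131) p.38] -/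
theorem ineq417_deltaB_flat (L : ℕ) (hL : 2 ≤ L) (F W : B7Prop1Explicit.Site d → Fin d → 𝔸) (j : ℕ) (ν : Fin d)
    (z : B7Prop1Explicit.Site d) (μ : Fin d) {b b₁ g gW ω ρ : ℝ} (hb : 0 ≤ b) (hk : C3 d L * ((L : ℝ) ^ j * b₁) ≤ 1)
    (hF : ∀ x κ, ‖F x κ‖ ≤ b) (hg0 : 0 ≤ g) (hg : ∀ x κ, ‖F (x + e ν) κ - F x κ‖ ≤ g)
    (hω : 0 ≤ ω) (hW : ∀ x κ, ‖W x κ‖ ≤ ω) (hgW0 : 0 ≤ gW) (hgW : ∀ x κ, ‖W (x + e ν) κ - W x κ‖ ≤ gW)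
    (hρ : 0 < ρ) (hroom : b + (L : ℝ) ^ j * g + 2 * ρ ≤ b₁) :
    ‖dQ L (1 : B7Prop1Explicit.Site d → Fin d → 𝔸ˣ) F W j (z + e ν) μ - dQ L (1 : B7Prop1Explicit.Site d → Fin d → 𝔸ˣ) F W j z μ‖
      ≤ 2 * ((L : ℝ) ^ j * b₁) * ((L : ℝ) ^ j * gW) / ρ + 2 * ((L : ℝ) ^ j * b₁) * ω * ((L : ℝ) ^ j * g) / ρ ^ 2 + 0 := by
  have hL1 : 1 ≤ L := le_trans (by norm_num) hL
  have hb₁0 : 0 ≤ b₁ := by nlinarith [pow_nonneg (Nat.cast_nonneg L : (0 : ℝ) ≤ L) j]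
  set S := boxBonds L j z μ with hS
  set T := oneBond (d := d) z μ with hT
  have hchart : ∀ G : B7Prop1Explicit.Site d → Fin d → 𝔸,
      logCovIter L (shiftCfg (((L : ℤ) ^ j) • e ν) (1 : B7Prop1Explicit.Site d → Fin d → 𝔸ˣ)) G j z μ
        = (fun q : S → 𝔸 => avgMap L S T j q (theBond z μ)) (restr S G) := by
    intro G
    rw [shiftCfg_one, logCovIter_one_left]
    exact logIter_eq_avgMap_restr L hL1 G j z μ
  have hφ : AnalyticOnNhd ℂ (fun q : S → 𝔸 => avgMap L S T j q (theBond z μ)) (ball 0 b₁) := by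
    intro q hq
    have hq' : ∀ s, ‖q s‖ ≤ b₁ := fun s => le_trans (norm_le_pi_norm q s) (mem_ball_zero_iff.1 hq).le
    exact analyticAt_avgMap_apply L hL S T j hb₁0 hk hq' (theBond z μ)
  have hM : ∀ q ∈ ball (0 : S → 𝔸) b₁, ‖(fun q : S → 𝔸 => avgMap L S T j q (theBond z μ)) q‖ ≤ 2 * ((L : ℝ) ^ j * b₁) := by
    intro q hq
    have hq' : ∀ s, ‖q s‖ ≤ b₁ := fun s => le_trans (norm_le_pi_norm q s) (mem_ball_zero_iff.1 hq).le
    simp only [avgMap_apply]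
    exact norm_logIter_le L hL (insCfg S q) j hb₁0 hk (norm_insCfg_le_of_le hb₁0 hq') _ _
  have hbg : ‖dQ L (shiftCfg (((L : ℤ) ^ j) • e ν) (1 : B7Prop1Explicit.Site d → Fin d → 𝔸ˣ)) F W j z μ
      - dQ L (1 : B7Prop1Explicit.Site d → Fin d → 𝔸ˣ) F W j z μ‖ ≤ 0 := by
    rw [shiftCfg_one, sub_self, norm_zero]
  exact ineq417_deltaB_general L (1 : B7Prop1Explicit.Site d → Fin d → 𝔸ˣ) F W j ν z μ
    (fun q : S → 𝔸 => avgMap L S T j q (theBond z μ)) hchart hφ (by positivity) hM hb hF hg0 hg hω hW hgW0 hgW hρ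
    hroom hbg

end Flat

end Literature.MathematicalPhysics.QuantumFieldTheory.Balaban1983to89.B12Ineq417DeltaB

end
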